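import Literature.RingTheory.FormalGroups.NilpotentPointLaws
import Literature.RingTheory.FormalGroups.FormalGroupHomNeg
import HarnessLib

/-!
# Torsion points of a commutative formal group law in a nilpotent algebra: `F[m](R) = {x ∈ Nil(R) ∣ [m]_F(x) = 0}` is stable under
# `0`, `F`-addition, `F`-inverse, endomorphisms and enlarging `m` ([Hazewinkel 1978] §1.2; P6d points currency (β), part 5)

Topic `Literature/RingTheory/FormalGroups`; namespace `Literature.RingTheory.FormalGroups`.  THEOREMS ONLY (no definition, no named fact,
no instance, no notation, no `sorry`).  Cell `hodgecm-mathlib`, P6 «MOD programme» ROW 4B: the SERIES identities `[m] ∘ φ = φ ∘ [m]`,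
`[m] ∘ [n] = [mn]`, `φ ∘ ι_F = ι_G ∘ φ` for homomorphisms of commutative formal group laws (★ `FormalGroupHomAdd.nsmulHom`, ★
`FormalGroupHomNeg.negHom`), and their consequences for NILPOTENT POINTS (★ `NilpotentEvaluation.evalNilp`, ★ `NilpotentPointLaws`): the
`m`-torsion condition `[m]_F(x) = 0` is preserved by `x +_F y := evalNilp₂ F x y`, by `ι_F`, by every homomorphism, by `0`, and passes from
`m` to `k m`.  The torsion SUBTYPE itself (`TorsPts`) is the P6d dictionary's vocabulary and is NOT declared here — these are the
element-level facts its group structure is assembled from.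

## Contents

* `FormalGroupHom.nsmulHom_comp` — `[m]_G ∘ φ = φ ∘ [m]_F`; `FormalGroupHom.nsmulHom_mul` — `[m n]_F = [m]_F ∘ [n]_F`;
  `FormalGroupHom.comp_negHom` — `φ ∘ ι_F = ι_G ∘ φ`; `FormalGroupHom.nsmulHom_comp_negHom`.
* `evalNilp_at_zero`, `FormalGroupHom.evalNilp_apply_zero` — `f(0) = f₀`, `φ(0) = 0`.
* `FormalGroupHom.evalNilp_nsmulHom_comm` — `[m]_G(φ(x)) = φ([m]_F(x))`; `evalNilp_nsmulHom_negSeries` — `[m](ι x) = ι([m] x)`;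
  `FormalGroupHom.evalNilp_nsmulHom_mul` — `[m n](x) = [m]([n](x))`.
* torsion closure: `nsmulTorsion_zero`, `nsmulTorsion_add`, `nsmulTorsion_negSeries`, `nsmulTorsion_hom`, `nsmulTorsion_mul_left∕right`,
  `nsmulTorsion_pow_of_le`.
-/

noncomputable section

namespace Literature.RingTheory.FormalGroups

universe u v

variable {A : Type u} [CommRing A] {R : Type v} [CommRing R] [Algebra A R]

/-! ## §1 Series identities: `[m]` commutes with homomorphisms, with itself, and with the inverse -/

namespace FormalGroupHom

variable {F G : FormalGroup A}

/-- **Homomorphisms commute with multiplication by `m`: `[m]_G ∘ φ = φ ∘ [m]_F`.** [cite: Hazewinkel1978, §1.2 (1.2.4)–(1.2.6)] -/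
theorem nsmulHom_comp [F.IsComm] [G.IsComm] (φ : FormalGroupHom F G) (m : ℕ) :
    (nsmulHom G m).comp φ = φ.comp (nsmulHom F m) := by
  induction m with
  | zero => rw [nsmulHom_zero, nsmulHom_zero, zero_comp, comp_zero]
  | succ m ih => rw [nsmulHom_succ, nsmulHom_succ, add_comp, comp_add, ih, id_comp, comp_id]

/-- **`[m n]_F = [m]_F ∘ [n]_F`.** [cite: Hazewinkel1978, §1.2 (1.2.4)–(1.2.6)] -/
theorem nsmulHom_mul [F.IsComm] (m n : ℕ) : nsmulHom F (m * n) = (nsmulHom F m).comp (nsmulHom F n) := by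
  induction m with
  | zero => rw [Nat.zero_mul, nsmulHom_zero, zero_comp]
  | succ m ih => rw [Nat.succ_mul, nsmulHom_add, ih, nsmulHom_succ, add_comp, id_comp]

/-- **Homomorphisms commute with the inverse: `φ ∘ ι_F = ι_G ∘ φ`** (both are the additive inverse of `φ`). [cite: Hazewinkel1978, §1.2 (1.2.6)] -/
theorem comp_negHom [F.IsComm] [G.IsComm] (φ : FormalGroupHom F G) : φ.comp (negHom F) = (negHom G).comp φ := by
  have h := comp_neg φ (FormalGroupHom.id F)
  rw [neg, comp_id, comp_id] at h
  rw [h, neg]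

/-- `[m]_F ∘ ι_F = ι_F ∘ [m]_F`. [cite: Hazewinkel1978, §1.2 (1.2.6)] -/
theorem nsmulHom_comp_negHom [F.IsComm] (m : ℕ) : (nsmulHom F m).comp (negHom F) = (negHom F).comp (nsmulHom F m) :=
  comp_negHom _

end FormalGroupHom

/-! ## §2 Values at `0` -/

/-- `f(0) = f₀` (the constant coefficient) for the nilpotent point `0`. [cite: BourbakiAlgebraII2003, Ch. IV §4 no. 3] -/
theorem evalNilp_at_zero (f : PowerSeries A) : evalNilp f (0 : R) = algebraMap A R (PowerSeries.constantCoeff f) := by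
  rw [evalNilp_eq_sum f (pow_one (0 : R)), Finset.sum_range_one, pow_zero, mul_one, PowerSeries.coeff_zero_eq_constantCoeff]

/-- **`φ(0) = 0`** for a homomorphism of formal group laws. [cite: Hazewinkel1978, §1.2 Def. (1.2.1)] -/
theorem FormalGroupHom.evalNilp_apply_zero {F G : FormalGroup A} (φ : FormalGroupHom F G) : evalNilp φ.toPowerSeries (0 : R) = 0 := by
  rw [evalNilp_at_zero, φ.constantCoeff_eq_zero, map_zero]

/-- `f(0) = 0` whenever `f₀ = 0`. [cite: BourbakiAlgebraII2003, Ch. IV §4 no. 3] -/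
theorem evalNilp_at_zero_of_constantCoeff {f : PowerSeries A} (hf : PowerSeries.constantCoeff f = 0) : evalNilp f (0 : R) = 0 := by
  rw [evalNilp_at_zero, hf, map_zero]

/-! ## §3 `[m]` on points commutes with homomorphisms, with the inverse, and is multiplicative in `m` -/

namespace FormalGroupHom

variable {F G : FormalGroup A}

/-- **`[m]_G(φ(x)) = φ([m]_F(x))`** on nilpotent points. [cite: Hazewinkel1978, §1.2 (1.2.4)–(1.2.6)] -/
theorem evalNilp_nsmulHom_comm [F.IsComm] [G.IsComm] (φ : FormalGroupHom F G) (m : ℕ) {x : R} (hx : IsNilpotent x) :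
    evalNilp (nsmulHom G m).toPowerSeries (evalNilp φ.toPowerSeries x) = evalNilp φ.toPowerSeries (evalNilp (nsmulHom F m).toPowerSeries x) := by
  rw [← evalNilp_comp _ _ hx, nsmulHom_comp, evalNilp_comp _ _ hx]

/-- **`[m n]_F(x) = [m]_F([n]_F(x))`** on nilpotent points. [cite: Hazewinkel1978, §1.2 (1.2.4)] -/
theorem evalNilp_nsmulHom_mul [F.IsComm] (m n : ℕ) {x : R} (hx : IsNilpotent x) :
    evalNilp (nsmulHom F (m * n)).toPowerSeries x = evalNilp (nsmulHom F m).toPowerSeries (evalNilp (nsmulHom F n).toPowerSeries x) := by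
  rw [nsmulHom_mul, evalNilp_comp _ _ hx]

end FormalGroupHom

/-- **`[m]_F(ι_F(x)) = ι_F([m]_F(x))`** on nilpotent points. [cite: Hazewinkel1978, §1.2 (1.2.6)] -/
theorem evalNilp_nsmulHom_negSeries (F : FormalGroup A) [F.IsComm] (m : ℕ) {x : R} (hx : IsNilpotent x) :
    evalNilp (FormalGroupHom.nsmulHom F m).toPowerSeries (evalNilp (FormalGroupNeg.negSeries F) x) =
      evalNilp (FormalGroupNeg.negSeries F) (evalNilp (FormalGroupHom.nsmulHom F m).toPowerSeries x) := by
  rw [← FormalGroupHom.negHom_toPowerSeries, ← evalNilp_comp _ _ hx, FormalGroupHom.nsmulHom_comp_negHom, evalNilp_comp _ _ hx]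

/-! ## §4 Closure properties of the `m`-torsion condition `[m]_F(x) = 0` -/

section Torsion

variable (F : FormalGroup A) [F.IsComm]

/-- `0` is `m`-torsion: `[m]_F(0) = 0`. [cite: Hazewinkel1978, §1.2 (1.2.4)] -/
theorem nsmulTorsion_zero (m : ℕ) : evalNilp (FormalGroupHom.nsmulHom F m).toPowerSeries (0 : R) = 0 :=
  (FormalGroupHom.nsmulHom F m).evalNilp_apply_zero

variable {F}

/-- **`m`-torsion points are stable under `F`-addition**: `[m](x) = [m](y) = 0 ⇒ [m](x +_F y) = 0`.
[cite: Hazewinkel1978, §1.2 (1.2.4)–(1.2.5)] -/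
theorem nsmulTorsion_add (m : ℕ) {x y : R} (hx : IsNilpotent x) (hy : IsNilpotent y)
    (hx0 : evalNilp (FormalGroupHom.nsmulHom F m).toPowerSeries x = 0) (hy0 : evalNilp (FormalGroupHom.nsmulHom F m).toPowerSeries y = 0) :
    evalNilp (FormalGroupHom.nsmulHom F m).toPowerSeries (evalNilp₂ F.toPowerSeries x y) = 0 := by
  rw [(FormalGroupHom.nsmulHom F m).evalNilp_evalNilp₂ hx hy, hx0, hy0, evalNilp₂_zero_right F IsNilpotent.zero]

/-- **`m`-torsion points are stable under the inverse**: `[m](x) = 0 ⇒ [m](ι_F x) = 0`. [cite: Hazewinkel1978, §1.2 (1.2.6)] -/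
theorem nsmulTorsion_negSeries (m : ℕ) {x : R} (hx : IsNilpotent x) (hx0 : evalNilp (FormalGroupHom.nsmulHom F m).toPowerSeries x = 0) :
    evalNilp (FormalGroupHom.nsmulHom F m).toPowerSeries (evalNilp (FormalGroupNeg.negSeries F) x) = 0 := by
  rw [evalNilp_nsmulHom_negSeries F m hx, hx0, evalNilp_at_zero_of_constantCoeff (FormalGroupNeg.constantCoeff_negSeries F)]

/-- **Homomorphisms carry `m`-torsion points to `m`-torsion points**: `[m]_F(x) = 0 ⇒ [m]_G(φ x) = 0` (in particular every
endomorphism `[a]_F` of a formal module law preserves `F[m]`). [cite: Hazewinkel1978, §1.2 (1.2.4)–(1.2.6)] -/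
theorem nsmulTorsion_hom {G : FormalGroup A} [G.IsComm] (φ : FormalGroupHom F G) (m : ℕ) {x : R} (hx : IsNilpotent x)
    (hx0 : evalNilp (FormalGroupHom.nsmulHom F m).toPowerSeries x = 0) :
    evalNilp (FormalGroupHom.nsmulHom G m).toPowerSeries (evalNilp φ.toPowerSeries x) = 0 := by
  rw [φ.evalNilp_nsmulHom_comm m hx, hx0, φ.evalNilp_apply_zero]

/-- `[m](x) = 0 ⇒ [k m](x) = 0`. [cite: Hazewinkel1978, §1.2 (1.2.4)] -/
theorem nsmulTorsion_mul_left (k m : ℕ) {x : R} (hx : IsNilpotent x) (hx0 : evalNilp (FormalGroupHom.nsmulHom F m).toPowerSeries x = 0) :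
    evalNilp (FormalGroupHom.nsmulHom F (k * m)).toPowerSeries x = 0 := by
  rw [FormalGroupHom.evalNilp_nsmulHom_mul k m hx, hx0, nsmulTorsion_zero]

/-- `[m](x) = 0 ⇒ [m k](x) = 0`. [cite: Hazewinkel1978, §1.2 (1.2.4)] -/
theorem nsmulTorsion_mul_right (m k : ℕ) {x : R} (hx : IsNilpotent x) (hx0 : evalNilp (FormalGroupHom.nsmulHom F m).toPowerSeries x = 0) :
    evalNilp (FormalGroupHom.nsmulHom F (m * k)).toPowerSeries x = 0 := by
  rw [Nat.mul_comm]; exact nsmulTorsion_mul_left k m hx hx0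

/-- **The torsion layers increase: `F[pⁿ] ⊆ F[pⁿ′]` for `n ≤ n′`** (`[pⁿ](x) = 0 ⇒ [pⁿ′](x) = 0`) — the inclusions `incl` of the
`p`-divisible group `F[p^∞]`. [cite: Hazewinkel1978, §1.2 (1.2.4)] -/
theorem nsmulTorsion_pow_of_le (p : ℕ) {n n' : ℕ} (h : n ≤ n') {x : R} (hx : IsNilpotent x)
    (hx0 : evalNilp (FormalGroupHom.nsmulHom F (p ^ n)).toPowerSeries x = 0) :
    evalNilp (FormalGroupHom.nsmulHom F (p ^ n')).toPowerSeries x = 0 := by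
  rw [← Nat.sub_add_cancel h, pow_add]
  exact nsmulTorsion_mul_left _ _ hx hx0

/-- `[m](x) = 0` and `[n](y)=0` ⇒ `[m n](x +_F y) = 0` (a common layer). [cite: Hazewinkel1978, §1.2 (1.2.4)] -/
theorem nsmulTorsion_add_mul (m n : ℕ) {x y : R} (hx : IsNilpotent x) (hy : IsNilpotent y)
    (hx0 : evalNilp (FormalGroupHom.nsmulHom F m).toPowerSeries x = 0) (hy0 : evalNilp (FormalGroupHom.nsmulHom F n).toPowerSeries y = 0) :
    evalNilp (FormalGroupHom.nsmulHom F (m * n)).toPowerSeries (evalNilp₂ F.toPowerSeries x y) = 0 :=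
  nsmulTorsion_add (m * n) hx hy (nsmulTorsion_mul_right m n hx hx0) (nsmulTorsion_mul_left m n hy hy0)

end Torsion

end Literature.RingTheory.FormalGroups
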